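import Mathlib.Analysis.SpecificLimits.Normed
import Mathlib.Analysis.SpecialFunctions.Pow.Real
import Mathlib.Analysis.SpecialFunctions.Log.Base
import Mathlib.Analysis.Normed.Ring.Basic
import HarnessLib

/-!
# Artin's weak triangle inequality (Cassels–Fröhlich, Ch. II §1)

Following Artin, Cassels (*Global Fields*, Ch. II of Cassels–Fröhlich, *Algebraic Number
Theory*, 1967, §1) defines a valuation of a field `k` as a map `|·| : k → ℝ≥0` with `|α| = 0 ↔ α = 0`,
`|αβ| = |α| |β|` and `|β + γ| ≤ C · max (|β|, |γ|)` for some constant `C`, and shows (footnote to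
§1) that for `C = 2` the genuine triangle inequality `|β + γ| ≤ |β| + |γ|` follows. We formalise
that deduction for a multiplicative map `f : R →*₀ ℝ` on a commutative ring:

* `Literature.NumberTheory.GaloisRepresentations.map_sum_le_pow_mul_of_card_le`: `f (∑_{j ∈ s} α_j) ≤ C ^ r · max |α_j|` if `#s ≤ 2 ^ r`;
* `Literature.NumberTheory.GaloisRepresentations.map_sum_le_card_pow_mul`: `f (∑_{j ∈ s} α_j) ≤ (2 #s) ^ c · max |α_j|` if `C ≤ 2 ^ c`;
* `Literature.NumberTheory.GaloisRepresentations.map_natCast_le_two_mul`: `f n ≤ 2 n` when `C = 2`;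
* `Literature.NumberTheory.GaloisRepresentations.map_add_le_add_of_map_natCast_le`: the triangle inequality, assuming the weak one with
  any constant `C` together with a linear bound `f n ≤ D · n` on the naturals (this slight
  generalisation of Cassels' footnote, with the same proof, is the form used for Weil's
  classification of local fields, where `f = mod_F ^ s` is normalised so that `f n = n`);
* `Literature.NumberTheory.GaloisRepresentations.map_add_le_add_of_map_add_le_two_mul_max`: Cassels' statement (`C = 2`);
* `Literature.NumberTheory.GaloisRepresentations.AbsoluteValue.ofMapAddLeTwoMulMax`: the resulting `AbsoluteValue R ℝ`;
* `Literature.NumberTheory.GaloisRepresentations.nnrealRPow`, `Literature.NumberTheory.GaloisRepresentations.exists_rpow_le_two`: replacing `f` by `f ^ t`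
  replaces `C` by `C ^ t`, and some `t > 0` achieves `C ^ t ≤ 2` ("every valuation is equivalent
  to one with `C = 2`", loc. cit.).
-/

open Finset Filter Topology

namespace Literature.NumberTheory.GaloisRepresentations

section Sums

variable {R : Type*} [CommRing R] (f : R →*₀ ℝ) {C : ℝ}
  (hC : ∀ x y, f (x + y) ≤ C * max (f x) (f y))

include hC

/-- If `f (x + y) ≤ C max (f x, f y)` then `f (∑_{j ∈ s} α_j) ≤ C ^ r · B` whenever `#s ≤ 2 ^ r`
and `f α_j ≤ B` for all `j` (Cassels–Fröhlich, Ch. II §1, footnote: "by induction").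
[cite: CasselsFrohlichANT1967, Ch. II §1, footnote] -/
theorem map_sum_le_pow_mul_of_card_le {ι : Type*} (r : ℕ) (s : Finset ι)
    (g : ι → R) {B : ℝ} (hB : 0 ≤ B) (hg : ∀ j ∈ s, f (g j) ≤ B) (hs : s.card ≤ 2 ^ r) :
    f (∑ j ∈ s, g j) ≤ C ^ r * B := by
  classical
  have hC1 : 1 ≤ C := by simpa using hC 1 0
  induction r generalizing s with
  | zero =>
    rw [pow_zero, one_mul]
    rw [pow_zero] at hs
    rcases s.eq_empty_or_nonempty with rfl | hne
    · simpa using hB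
    · obtain ⟨j, rfl⟩ := Finset.card_eq_one.mp (le_antisymm hs hne.card_pos)
      simpa using hg j (Finset.mem_singleton_self j)
  | succ r ih =>
    obtain ⟨t, hts, htcard⟩ := Finset.exists_subset_card_eq (Nat.div_le_self s.card 2)
    have h1 : t.card ≤ 2 ^ r := by rw [htcard]; omega
    have h2 : (s \ t).card ≤ 2 ^ r := by rw [Finset.card_sdiff_of_subset hts, htcard]; omega
    rw [← Finset.sum_sdiff hts]
    calc f (∑ j ∈ s \ t, g j + ∑ j ∈ t, g j)
        ≤ C * max (f (∑ j ∈ s \ t, g j)) (f (∑ j ∈ t, g j)) := hC _ _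
      _ ≤ C * (C ^ r * B) :=
        mul_le_mul_of_nonneg_left (max_le (ih _ (fun j hj => hg j (Finset.sdiff_subset hj)) h2)
          (ih _ (fun j hj => hg j (hts hj)) h1)) (zero_le_one.trans hC1)
      _ = C ^ (r + 1) * B := by ring

/-- If `f (x + y) ≤ C max (f x, f y)` with `C ≤ 2 ^ c`, then for a nonempty finite family
`f (∑_{j ∈ s} α_j) ≤ (2 #s) ^ c · B` whenever `f α_j ≤ B` for all `j` ("on inserting `2 ^ r - n` zero
summands", Cassels–Fröhlich, Ch. II §1, footnote, where `c = 1`).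
[cite: CasselsFrohlichANT1967, Ch. II §1, footnote] -/
theorem map_sum_le_card_pow_mul {c : ℕ} (hc : C ≤ 2 ^ c) {ι : Type*}
    (s : Finset ι) (hs : s.Nonempty) (g : ι → R) {B : ℝ} (hB : 0 ≤ B)
    (hg : ∀ j ∈ s, f (g j) ≤ B) :
    f (∑ j ∈ s, g j) ≤ (2 * s.card : ℝ) ^ c * B := by
  have hC1 : 1 ≤ C := by simpa using hC 1 0
  set k := Nat.clog 2 s.card with hk
  have hsk : s.card ≤ 2 ^ k := Nat.le_pow_clog one_lt_two _
  have hnat : 2 ^ k ≤ 2 * s.card := by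
    rcases Nat.eq_zero_or_pos k with hk0 | hkpos
    · rw [hk0, pow_zero]
      have := hs.card_pos
      omega
    · rcases lt_or_ge 1 s.card with hlt | hle
      · have h1 := Nat.pow_pred_clog_lt_self one_lt_two hlt
        rw [← hk] at h1
        have h' : 2 ^ k = 2 * 2 ^ k.pred := by
          rw [← pow_succ', ← Nat.succ_eq_add_one, Nat.succ_pred_eq_of_pos hkpos]
        rw [h']
        exact Nat.mul_le_mul_left 2 h1.le
      · -- `s.card = 1`, so `k = 0`, contradiction with `0 < k`
        have hs1 : s.card = 1 := le_antisymm hle hs.card_pos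
        rw [hs1, Nat.clog_one_right] at hk
        omega
  have h2k : (2 : ℝ) ^ k ≤ 2 * s.card := by exact_mod_cast hnat
  calc f (∑ j ∈ s, g j) ≤ C ^ k * B := map_sum_le_pow_mul_of_card_le f hC k s g hB hg hsk
    _ ≤ (2 ^ c) ^ k * B := by gcongr
    _ = ((2 : ℝ) ^ k) ^ c * B := by ring
    _ ≤ (2 * s.card : ℝ) ^ c * B := by gcongr

/-- **Artin's criterion** (Cassels–Fröhlich, Ch. II §1, footnote, slightly generalised): if
`f : R →*₀ ℝ` is non-negative, satisfies the weak triangle inequality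
`f (x + y) ≤ C · max (f x, f y)` for some constant `C`, and grows at most linearly on the natural
numbers, `f n ≤ D · n`, then `f` satisfies the triangle inequality. (Cassels treats `C = 2`,
where `f n ≤ 2 n` is automatic, see `map_natCast_le_two_mul`; the proof — expand `(x + y) ^ n`
binomially, bound the `n + 1` terms, extract `n`-th roots — is the same.)
[cite: CasselsFrohlichANT1967, Ch. II §1, footnote] -/
theorem map_add_le_add_of_map_natCast_le (hf0 : ∀ x, 0 ≤ f x) {D : ℝ}
    (hD : ∀ m : ℕ, f m ≤ D * m) (x y : R) : f (x + y) ≤ f x + f y := by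
  obtain ⟨c, hc⟩ := pow_unbounded_of_one_lt C (one_lt_two (α := ℝ))
  -- we may assume `D ≥ 1`
  set D' := max D 1 with hD'def
  have hD' : ∀ m : ℕ, f m ≤ D' * m := fun m =>
    (hD m).trans (mul_le_mul_of_nonneg_right (le_max_left _ _) m.cast_nonneg)
  have hD'pos : 0 < D' := lt_of_lt_of_le one_pos (le_max_right _ _)
  have ha : 0 ≤ f x := hf0 x
  have hb : 0 ≤ f y := hf0 y
  set a := f x with hadef
  set b := f y with hbdef
  set u := f (x + y) with hudef
  -- the key estimate `u ^ n ≤ (2 (n + 1)) ^ c · D' · (a + b) ^ n`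
  have key : ∀ n : ℕ, u ^ n ≤ (2 * ((n + 1 : ℕ) : ℝ)) ^ c * (D' * (a + b) ^ n) := by
    intro n
    rw [hudef, ← map_pow, add_pow]
    have h := map_sum_le_card_pow_mul f hC hc.le (Finset.range (n + 1)) (by simp)
      (fun m => x ^ m * y ^ (n - m) * (n.choose m : R)) (B := D' * (a + b) ^ n) (by positivity)
      (fun m hm => by
        rw [map_mul, map_mul, map_pow, map_pow, ← hadef, ← hbdef]
        calc a ^ m * b ^ (n - m) * f (n.choose m : R)
            ≤ a ^ m * b ^ (n - m) * (D' * n.choose m) := by gcongr; exact hD' _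
          _ = D' * (a ^ m * b ^ (n - m) * n.choose m) := by ring
          _ ≤ D' * (a + b) ^ n := by
            gcongr
            rw [add_pow]
            exact Finset.single_le_sum (f := fun k => a ^ k * b ^ (n - k) * (n.choose k : ℝ))
              (fun k _ => by positivity) hm)
    simpa using h
  by_contra! hlt
  have hab0 : 0 ≤ a + b := add_nonneg ha hb
  rcases hab0.eq_or_lt with hab | hab
  · have h1 := key 1
    rw [← hab] at h1
    simp at h1
    linarith
  · set q := u / (a + b) with hq
    have hq1 : 1 < q := (one_lt_div hab).mpr hlt
    have hqn : ∀ n : ℕ, q ^ n ≤ (2 * ((n + 1 : ℕ) : ℝ)) ^ c * D' := by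
      intro n
      rw [hq, div_pow, div_le_iff₀ (pow_pos hab n)]
      calc u ^ n ≤ _ := key n
        _ = _ := by ring
    have hlim := tendsto_pow_const_div_const_pow_of_one_lt c hq1
    have hev := (tendsto_order.mp hlim).2 (1 / ((4 : ℝ) ^ c * D')) (by positivity)
    obtain ⟨n, hn, hn1⟩ := (hev.and (eventually_ge_atTop 1)).exists
    have h1 : (2 * ((n + 1 : ℕ) : ℝ)) ^ c * D' ≤ (4 : ℝ) ^ c * D' * (n : ℝ) ^ c := by
      have hn1' : (1 : ℝ) ≤ n := by exact_mod_cast hn1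
      have : (2 * ((n + 1 : ℕ) : ℝ)) ≤ 4 * n := by push_cast; linarith
      calc (2 * ((n + 1 : ℕ) : ℝ)) ^ c * D' ≤ (4 * n) ^ c * D' := by gcongr
        _ = 4 ^ c * D' * n ^ c := by ring
    have h2 : q ^ n ≤ 4 ^ c * D' * n ^ c := (hqn n).trans h1
    rw [div_lt_div_iff₀ (pow_pos (zero_lt_one.trans hq1) n) (by positivity), one_mul] at hn
    nlinarith [h2, hn]

omit hC in
/-- For `C = 2` the weak triangle inequality gives `f n ≤ 2 n` on the naturals
(Cassels–Fröhlich, Ch. II §1, footnote: "in particular `|n| ≤ 2n |1| = 2n`").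
[cite: CasselsFrohlichANT1967, Ch. II §1, footnote] -/
theorem map_natCast_le_two_mul (h2 : ∀ x y, f (x + y) ≤ 2 * max (f x) (f y)) (m : ℕ) :
    f m ≤ 2 * m := by
  rcases Nat.eq_zero_or_pos m with rfl | hm
  · simp
  · have h := map_sum_le_card_pow_mul f h2 (c := 1) (by norm_num) (Finset.range m)
      (Finset.nonempty_range_iff.mpr hm.ne') (fun _ => (1 : R)) zero_le_one (fun j _ => by simp)
    simpa using h

omit hC in
/-- **Cassels–Fröhlich, Ch. II §1, footnote** (after Artin): a non-negative multiplicative map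
`f : R →*₀ ℝ` with `f (x + y) ≤ 2 · max (f x, f y)` satisfies the triangle inequality
`f (x + y) ≤ f x + f y`. [cite: CasselsFrohlichANT1967, Ch. II §1, footnote] -/
theorem map_add_le_add_of_map_add_le_two_mul_max (hf0 : ∀ x, 0 ≤ f x)
    (h2 : ∀ x y, f (x + y) ≤ 2 * max (f x) (f y)) (x y : R) : f (x + y) ≤ f x + f y :=
  map_add_le_add_of_map_natCast_le f h2 hf0 (map_natCast_le_two_mul f h2) x y

end Sums

section AbsoluteValue

variable {R : Type*} [CommRing R]

/-- A non-negative multiplicative map `f : R →*₀ ℝ` vanishing only at `0` and satisfying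
`f (x + y) ≤ 2 · max (f x, f y)` is an absolute value (a "valuation" in the sense of Artin and
Cassels with constant `C = 2`; Cassels–Fröhlich, Ch. II §1).
[cite: CasselsFrohlichANT1967, Ch. II §1, Definition and footnote] -/
def AbsoluteValue.ofMapAddLeTwoMulMax (f : R →*₀ ℝ) (hf0 : ∀ x, 0 ≤ f x)
    (hf : ∀ x, f x = 0 → x = 0) (h2 : ∀ x y, f (x + y) ≤ 2 * max (f x) (f y)) :
    AbsoluteValue R ℝ where
  toFun := f
  map_mul' := map_mul f
  nonneg' := hf0
  eq_zero' x := ⟨hf x, fun h => by rw [h, map_zero]⟩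
  add_le' := map_add_le_add_of_map_add_le_two_mul_max f hf0 h2

/-- Unfolding lemma for `AbsoluteValue.ofMapAddLeTwoMulMax`. [folklore] -/
@[simp]
theorem AbsoluteValue.ofMapAddLeTwoMulMax_apply (f : R →*₀ ℝ) (hf0 : ∀ x, 0 ≤ f x)
    (hf : ∀ x, f x = 0 → x = 0) (h2 : ∀ x y, f (x + y) ≤ 2 * max (f x) (f y)) (x : R) :
    AbsoluteValue.ofMapAddLeTwoMulMax f hf0 hf h2 x = f x :=
  rfl

end AbsoluteValue

section RPow

open scoped NNReal

variable {R : Type*} [CommRing R]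

/-- The power `f ^ t` (`t > 0`) of an `ℝ≥0`-valued multiplicative map, as a real-valued monoid with
zero homomorphism ("if `|α|₁` is a valuation then so is `|α|₁ ^ c`", Cassels–Fröhlich, Ch. II §1).
[cite: CasselsFrohlichANT1967, Ch. II §1, Note after (1.1)] -/
noncomputable def nnrealRPow (f : R →*₀ ℝ≥0) {t : ℝ} (ht : 0 < t) :
    R →*₀ ℝ where
  toFun x := (f x : ℝ) ^ t
  map_zero' := by simp [Real.zero_rpow ht.ne']
  map_one' := by simp
  map_mul' x y := by
    simp only [map_mul, NNReal.coe_mul]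
    exact Real.mul_rpow (NNReal.coe_nonneg (f x)) (NNReal.coe_nonneg (f y))

/-- Unfolding lemma. [folklore] -/
@[simp]
theorem nnrealRPow_apply (f : R →*₀ ℝ≥0) {t : ℝ} (ht : 0 < t) (x : R) :
    nnrealRPow f ht x = (f x : ℝ) ^ t :=
  rfl

/-- `f ^ t ≥ 0`. [folklore] -/
theorem nnrealRPow_nonneg (f : R →*₀ ℝ≥0) {t : ℝ} (ht : 0 < t) (x : R) :
    0 ≤ nnrealRPow f ht x :=
  Real.rpow_nonneg (NNReal.coe_nonneg (f x)) t

/-- `f ^ t` vanishes exactly where `f` does. [folklore] -/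
theorem nnrealRPow_eq_zero_iff (f : R →*₀ ℝ≥0) {t : ℝ} (ht : 0 < t) (x : R) :
    nnrealRPow f ht x = 0 ↔ f x = 0 := by
  rw [nnrealRPow_apply, Real.rpow_eq_zero_iff_of_nonneg (NNReal.coe_nonneg (f x))]
  simp [ht.ne']

/-- Passing to `f ^ t` turns the weak triangle inequality with constant `A` into the one with
constant `A ^ t` (Cassels–Fröhlich, Ch. II §1: equivalent valuations).
[cite: CasselsFrohlichANT1967, Ch. II §1, Note after (1.1)] -/
theorem nnrealRPow_add_le (f : R →*₀ ℝ≥0) {t : ℝ} (ht : 0 < t) {A : ℝ≥0}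
    (hA : ∀ x y, f (x + y) ≤ A * max (f x) (f y)) (x y : R) :
    nnrealRPow f ht (x + y) ≤ (A : ℝ) ^ t * max (nnrealRPow f ht x) (nnrealRPow f ht y) := by
  simp only [nnrealRPow_apply]
  have h' : ((f (x + y) : ℝ≥0) : ℝ) ≤ A * max (f x : ℝ) (f y : ℝ) := by exact_mod_cast hA x y
  calc ((f (x + y) : ℝ≥0) : ℝ) ^ t ≤ ((A : ℝ) * max (f x : ℝ) (f y)) ^ t :=
        Real.rpow_le_rpow (NNReal.coe_nonneg (f (x + y))) h' ht.le
    _ = (A : ℝ) ^ t * (max (f x : ℝ) (f y)) ^ t :=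
        Real.mul_rpow (NNReal.coe_nonneg A) (le_max_of_le_left (NNReal.coe_nonneg (f x)))
    _ = (A : ℝ) ^ t * max ((f x : ℝ) ^ t) ((f y : ℝ) ^ t) := by
        rw [Real.rpow_max (NNReal.coe_nonneg (f x)) (NNReal.coe_nonneg (f y)) ht.le]

omit [CommRing R] in
/-- Every real constant `A` has a power `A ^ t ≤ 2` with `t > 0` ("trivially every valuation is
equivalent to one with `C = 2`", Cassels–Fröhlich, Ch. II §1).
[cite: CasselsFrohlichANT1967, Ch. II §1, remark before the footnote] -/
theorem exists_rpow_le_two (A : ℝ) : ∃ t : ℝ, 0 < t ∧ A ^ t ≤ 2 := by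
  rcases le_or_gt A 2 with h | h
  · exact ⟨1, one_pos, by simpa using h⟩
  · refine ⟨Real.logb A 2, Real.logb_pos (one_lt_two.trans h) one_lt_two, le_of_eq ?_⟩
    exact Real.rpow_logb (by linarith) (by linarith) two_pos

end RPow

end Literature.NumberTheory.GaloisRepresentations
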